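import Summits.Parity.GeneralizedHardyLittlewood.Theorems.LeeYangFibresAbsoluteUpgradeClipCellsWalsh
import Literature.NumberTheory.Sieve.LinearEquationsInPrimesOneForm
import Literature.NumberTheory.Sieve.LinearEquationsInPrimesDimOne
import Literature.NumberTheory.Sieve.LinearEquationsInPrimesTwinSystem
import Literature.NumberTheory.Sieve.LinearEquationsInPrimesEnvelopingSieveCorrelations
import HarnessLib

/-!
# Route `LeeYangFibres`, crux `AbsoluteUpgrade` (stmt-Parity-14116), line `nlc-cells-absolute-clip`:
# one-scale lemmas for the clipping assembly (helper file for the registered stub `stub_clipCells`)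

* The `(t, L) = (1, 1)` instance of `SinglesDecay`: for the identity form `ψ(n) = n` (the tree's `idForm`) and
  the full box `K = [-N, N]` one has `β_∞ = N` (`archFactor_idForm`), `∏_p β_p = 1`
  (`singularProduct_idForm`), and the rough tuples are the `N^{1/u}`-rough integers `2 ≤ n ≤ N`, so
  `SinglesDecay` yields the PARITY BALANCE of the rough integers along the slow range,
  `|Σ_{m ≤ u} (−1)^m A_m(N)| ≤ C e^{−cu} N u/log N + N/log² N` (`clipCells_identityForm`).
* `abs_theta_singleton_le` — the single amplitudes at one scale: the marginal Walsh identity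
  (`abs_theta_singleton_mul_pow_le`) against the cell law errors.
* `walsh_corner_clip` — the high-mass clipping at one scale: normalising the corner cells by the
  product model turns the cell law and corner NLC into the hypotheses of `WalshClipping`
  (`m_{j ∨ j'} m_{j ∧ j'} = m_j m_{j'}` because the model is a product over the forms).
-/

noncomputable section

open scoped BigOperators
open Finset Filter MeasureTheory

namespace Summit.Parity.GeneralizedHardyLittlewood.Theorems.AbsoluteUpgrade

open Literature.NumberTheory.Sieve
open Summit.Parity.GeneralizedHardyLittlewood.Cruxes.AbsoluteUpgrade.NlcCellsAbsoluteClip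

variable {t : ℕ}

/-! ## The identity form `ψ(n) = n` on the box `[-N, N]` -/

/-! The identity form `ψ(n) = n` is the tree's `Literature.NumberTheory.Sieve.idForm` (`a = 1`, `b = 0`;
`idForm_eval`, `idForm_realEval`, `idForm_props`: non-degenerate, `‖(n)‖_N = 1`). -/

/-- `β_∞((n), [-N, N]) = vol (0, N] = N`. [folklore] -/
theorem archFactor_idForm (N : ℕ) : archFactor idForm (realBox 1 N) = N := by
  unfold archFactor
  have hset : realBox 1 (N : ℝ) ∩ {x | ∀ i, 0 < (idForm i).realEval x} =
      Set.pi Set.univ (fun _ : Fin 1 => Set.Ioc (0 : ℝ) N) := by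
    ext x
    simp only [realBox, Set.mem_inter_iff, Set.mem_Icc, Set.mem_setOf_eq, Set.mem_pi,
      Set.mem_univ, true_implies, Set.mem_Ioc, Fin.forall_fin_one, Pi.le_def, idForm_realEval]
    constructor
    · rintro ⟨⟨-, h2⟩, h3⟩
      exact ⟨h3, h2⟩
    · rintro ⟨h1, h2⟩
      have hN : (0 : ℝ) ≤ N := Nat.cast_nonneg N
      exact ⟨⟨by linarith, h2⟩, h1⟩
  rw [hset, Real.volume_pi_Ioc_toReal]
  · simp
  · intro i
    exact Nat.cast_nonneg N

/-- `∏_p β_p((n)) = 1` (`gcd(1, 0) = 1`, `|a|/φ(|a|) = 1`). [folklore] -/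
theorem singularProduct_idForm : singularProduct idForm = 1 := by
  rw [OneForm.singularProduct_eq idForm (by simp [idForm])]
  simp [idForm]

/-- For `N^{1/u} ≥ 2` the joint cell of the identity form over `[-N, N]` at index `(m)` is the model
cell `A_m(N)`: non-positive `n` are not rough (`minFac 0 = 2 ≤ N^{1/u}`). [folklore] -/
theorem jointCell_idForm {N u : ℕ} (hz2 : (2 : ℝ) ≤ (N : ℝ) ^ ((1 : ℝ) / u)) (m : ℕ) :
    jointCell idForm (realBox 1 N) N u (fun _ => m) = roughCell N u m := by
  classical
  unfold jointCell roughCell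
  rw [DimOne.card_filter_latticeBox]
  symm
  refine Finset.card_nbij' (fun n : ℕ => (n : ℤ)) (fun n : ℤ => n.toNat) (fun n hn => ?_)
    (fun n hn => ?_) (fun n _ => by simp) (fun n hn => ?_)
  · -- `ℕ → ℤ`
    rw [mem_coe, mem_filter, mem_Icc] at hn
    obtain ⟨⟨h1, h2⟩, h3, h4⟩ := hn
    dsimp only
    rw [mem_coe, mem_filter, mem_Icc]
    refine ⟨⟨by omega, by exact_mod_cast h2⟩, ?_, fun i => ?_⟩
    · simp only [realBox, DimOne.realPoint_const, Set.mem_Icc, Pi.le_def, Int.cast_natCast]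
      exact ⟨fun _ => by
        have : (0 : ℝ) ≤ n := Nat.cast_nonneg n
        linarith [(Nat.cast_nonneg N : (0 : ℝ) ≤ N)], fun _ => by exact_mod_cast h2⟩
    · rw [idForm_eval, Int.toNat_natCast]
      exact ⟨h3, h4⟩
  · -- `ℤ → ℕ`
    rw [mem_coe, mem_filter, mem_Icc] at hn
    obtain ⟨⟨-, h2⟩, -, h3⟩ := hn
    have h30 := h3 0
    rw [idForm_eval] at h30
    dsimp only
    rw [mem_coe, mem_filter, mem_Icc]
    refine ⟨⟨?_, Int.toNat_le.mpr h2⟩, h30⟩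
    by_contra h0
    push Not at h0
    have h00 : n.toNat = 0 := by omega
    rw [h00, Nat.minFac_zero, Nat.cast_ofNat] at h30
    linarith [h30.1]
  · -- right inverse on the rough part: `n > 0`
    rw [mem_coe, mem_filter] at hn
    obtain ⟨-, -, h3⟩ := hn
    have h30 := (h3 0).1
    rw [idForm_eval] at h30
    have hpos : 0 < n := by
      by_contra h0
      push Not at h0
      rw [Int.toNat_of_nonpos h0, Nat.minFac_zero, Nat.cast_ofNat] at h30
      linarith
    dsimp only
    exact Int.toNat_of_nonneg hpos.le

/-- The parity marginal of the identity form over `[-N, N]` is the alternating cell sum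
`Σ_{m ≤ u} (−1)^m A_m(N)` (for `N^{1/u} ≥ 2`, `u ≥ 1`). [folklore] -/
theorem sum_roughTuples_idForm {N u : ℕ} (hN : 1 ≤ N) (hu : 1 ≤ u)
    (hz2 : (2 : ℝ) ≤ (N : ℝ) ^ ((1 : ℝ) / u)) :
    ∑ n ∈ roughTuples idForm (realBox 1 N) N u,
        (-1 : ℝ) ^ (ArithmeticFunction.cardFactors ((idForm 0).eval n).toNat) =
      ∑ m ∈ Icc 1 u, (-1 : ℝ) ^ m * (roughCell N u m : ℝ) := by
  have hL : affLinSize idForm N ≤ (1 : ℕ) := by rw [(idForm_props (N : ℝ)).2.2]; simp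
  rw [sum_roughTuples_sign_eq_sum_cells idForm (realBox 1 N) hN hu hL hz2 (by simpa using hz2) 0,
    sum_piFinset_const_fin_one]
  refine sum_congr rfl fun m _ => ?_
  rw [jointCell_idForm hz2]

/-- **Parity balance of the rough integers along the slow range** — the `(t, L) = (1, 1)` instance of
`SinglesDecay` (identity form, full box; `β_∞ = N`, `∏_p β_p = 1`):
`|Σ_{m ≤ u} (−1)^m A_m(N)| ≤ C e^{−cu} N u/log N + N/log² N` for `4 ≤ u ≤ A log₃ N`, `N ≥ N₀(A)`,
with `c` independent of `A` (registered sub-goal, stated verbatim as registered). [folklore] -/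
theorem clipCells_identityForm : SinglesDecay → ∃ c : ℝ, 0 < c ∧ ∀ A : ℝ, ∃ C : ℝ, 0 ≤ C ∧ ∃ N₀ : ℕ, ∀ N : ℕ, N₀ ≤ N → ∀ u : ℕ, 4 ≤ u → (u : ℝ) ≤ A * Real.log (Real.log (Real.log N)) → |∑ m ∈ Finset.Icc 1 u, (-1 : ℝ) ^ m * (roughCell N u m : ℝ)| ≤ C * Real.exp (-(c * u)) * N * ((u : ℝ) / Real.log N) + N / Real.log N ^ 2 := by
  intro hS
  obtain ⟨c, hc, hA⟩ := hS 1 1 le_rfl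
  refine ⟨c, hc, fun A => ?_⟩
  obtain ⟨C, N₀, hN₀⟩ := hA A
  obtain ⟨N₁, hN₁⟩ := exists_forall_le_rpow_inv A 2
  refine ⟨max C 0, le_max_right _ _, max N₀ (max N₁ 1), fun N hN u hu huA => ?_⟩
  have hN0 : N₀ ≤ N := le_trans (le_max_left _ _) hN
  have hN1 : N₁ ≤ N := le_trans ((le_max_left _ _).trans (le_max_right _ _)) hN
  have hN2 : 1 ≤ N := le_trans ((le_max_right _ _).trans (le_max_right _ _)) hN
  have hz2 : (2 : ℝ) ≤ (N : ℝ) ^ ((1 : ℝ) / u) := hN₁ N hN1 u (by omega) huA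
  have hL : affLinSize idForm N ≤ (1 : ℕ) := by rw [(idForm_props (N : ℝ)).2.2]; simp
  have key := hN₀ N hN0 u hu huA idForm (idForm_props (N : ℝ)).1 hL (realBox 1 N)
    (convex_Icc _ _) subset_rfl 0
  rw [sum_roughTuples_idForm hN2 (by omega) hz2, archFactor_idForm, singularProduct_idForm,
    mul_one, pow_one] at key
  refine key.trans ?_
  have hpos : 0 ≤ Real.exp (-(c * u)) * N * ((u : ℝ) / Real.log N) := by
    have : 0 ≤ Real.log (N : ℝ) := Real.log_natCast_nonneg N
    positivity
  have h1 : C * Real.exp (-(c * u)) * N * ((u : ℝ) / Real.log N) ≤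
      max C 0 * Real.exp (-(c * u)) * N * ((u : ℝ) / Real.log N) := by
    have := mul_le_mul_of_nonneg_right (le_max_left C 0) hpos
    simpa only [mul_assoc] using this
  have h2 : (N : ℝ) / Real.log N ^ (1 + 1) = N / Real.log N ^ 2 := by norm_num
  linarith

/-! ## The single amplitudes at one scale -/

/-- **Single amplitudes at one scale.** If the cells `C_j` obey the law
`|C_j − Θ_θ(j) M m_j| ≤ e₁` on `[1,u]^t` (`m_j = ∏_k a_{j_k}`, `a ≥ 0`, `M > 0`) and the signed `i`-th
marginal `Σ_j (−1)^{j_i} C_j` is at most `X` in absolute value, then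
`|θ_{{i}}| ≤ (X + u^t e₁)/(M â^t) + 2^{t+1} |ã|/â` — the marginal Walsh identity
(`abs_theta_singleton_mul_pow_le`) applied to `Σ_j (−1)^{j_i} Θ_θ(j) m_j = (Σ_j (−1)^{j_i} C_j − Σ_j (−1)^{j_i} E_j)/M`.
[folklore] -/
theorem abs_theta_singleton_le (θ : Finset (Fin t) → ℝ) (hθ2 : ∀ S, |θ S| ≤ 2)
    (C : (Fin t → ℕ) → ℝ) {M : ℝ} (hM : 0 < M) (a : ℕ → ℝ) (ha : ∀ m, 0 ≤ a m) {u : ℕ}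
    (hA : 0 < ∑ m ∈ Icc 1 u, a m) {e₁ X : ℝ} (i : Fin t)
    (hlaw : ∀ j ∈ Fintype.piFinset (fun _ : Fin t => Icc 1 u),
      |C j - walshForm θ j * (M * ∏ k, a (j k))| ≤ e₁)
    (hX : |∑ j ∈ Fintype.piFinset (fun _ : Fin t => Icc 1 u), (-1 : ℝ) ^ (j i) * C j| ≤ X) :
    |θ {i}| ≤ (X + (u : ℝ) ^ t * e₁) / (M * (∑ m ∈ Icc 1 u, a m) ^ t) +
      2 ^ (t + 1) * |∑ m ∈ Icc 1 u, (-1 : ℝ) ^ m * a m| / ∑ m ∈ Icc 1 u, a m := by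
  set A := ∑ m ∈ Icc 1 u, a m with hAdef
  set P := Fintype.piFinset (fun _ : Fin t => Icc 1 u) with hP
  have ht : 0 < t := i.pos
  have hAt : 0 < A ^ t := pow_pos hA t
  -- the model marginal
  have h1 : |∑ j ∈ P, (-1 : ℝ) ^ (j i) * (walshForm θ j * ∏ k, a (j k))| ≤ (X + (u : ℝ) ^ t * e₁) / M := by
    rw [le_div_iff₀ hM]
    have hdecomp : (∑ j ∈ P, (-1 : ℝ) ^ (j i) * (walshForm θ j * ∏ k, a (j k))) * M =
        ∑ j ∈ P, (-1 : ℝ) ^ (j i) * C j -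
          ∑ j ∈ P, (-1 : ℝ) ^ (j i) * (C j - walshForm θ j * (M * ∏ k, a (j k))) := by
      rw [← sum_sub_distrib, sum_mul]
      refine sum_congr rfl fun j _ => ?_
      ring
    have hE : |∑ j ∈ P, (-1 : ℝ) ^ (j i) * (C j - walshForm θ j * (M * ∏ k, a (j k)))| ≤
        (u : ℝ) ^ t * e₁ :=
      calc |∑ j ∈ P, (-1 : ℝ) ^ (j i) * (C j - walshForm θ j * (M * ∏ k, a (j k)))|
          ≤ ∑ j ∈ P, |(-1 : ℝ) ^ (j i) * (C j - walshForm θ j * (M * ∏ k, a (j k)))| :=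
            abs_sum_le_sum_abs _ _
        _ ≤ ∑ _j ∈ P, e₁ := sum_le_sum fun j hj => by
            rw [abs_mul, abs_neg_one_pow, one_mul]; exact hlaw j hj
        _ = (u : ℝ) ^ t * e₁ := by
            rw [sum_const, nsmul_eq_mul, hP, Fintype.card_piFinset_const, Nat.card_Icc,
              Nat.add_sub_cancel]
            push_cast
            ring
    calc |∑ j ∈ P, (-1 : ℝ) ^ (j i) * (walshForm θ j * ∏ k, a (j k))| * M
        = |(∑ j ∈ P, (-1 : ℝ) ^ (j i) * (walshForm θ j * ∏ k, a (j k))) * M| := by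
          rw [abs_mul, abs_of_pos hM]
      _ ≤ |∑ j ∈ P, (-1 : ℝ) ^ (j i) * C j| +
            |∑ j ∈ P, (-1 : ℝ) ^ (j i) * (C j - walshForm θ j * (M * ∏ k, a (j k)))| := by
          rw [hdecomp]; exact abs_sub _ _
      _ ≤ X + (u : ℝ) ^ t * e₁ := add_le_add hX hE
  have key := abs_theta_singleton_mul_pow_le θ hθ2 a ha u i
  have hpow : A ^ t = A ^ (t - 1) * A := by rw [← pow_succ, Nat.sub_add_cancel ht]
  calc |θ {i}| = (|θ {i}| * A ^ t) / A ^ t := by field_simp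
    _ ≤ (|∑ j ∈ P, (-1 : ℝ) ^ (j i) * (walshForm θ j * ∏ k, a (j k))| +
          2 ^ (t + 1) * |∑ m ∈ Icc 1 u, (-1 : ℝ) ^ m * a m| * A ^ (t - 1)) / A ^ t :=
        div_le_div_of_nonneg_right key hAt.le
    _ = |∑ j ∈ P, (-1 : ℝ) ^ (j i) * (walshForm θ j * ∏ k, a (j k))| / A ^ t +
          2 ^ (t + 1) * |∑ m ∈ Icc 1 u, (-1 : ℝ) ^ m * a m| / A := by
        rw [add_div, hpow]
        congr 1
        rw [mul_comm (A ^ (t - 1)) A, mul_div_mul_right _ _ (pow_pos hA _).ne']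
    _ ≤ (X + (u : ℝ) ^ t * e₁) / M / A ^ t + 2 ^ (t + 1) * |∑ m ∈ Icc 1 u, (-1 : ℝ) ^ m * a m| / A := by
        gcongr
    _ = _ := by rw [div_div]

/-! ## The high-mass clipping at one scale -/

/-- **The product model is NLC-extremal**: `m_{j ∨ j'} m_{j ∧ j'} = m_j m_{j'}` for `m_j = ∏_i a_{j_i}`
(coordinatewise `{max, min} = {j_i, j'_i}`). [folklore] -/
theorem prod_sup_mul_prod_inf (a : ℕ → ℝ) (j j' : Fin t → ℕ) :
    (∏ i, a ((j ⊔ j') i)) * ∏ i, a ((j ⊓ j') i) = (∏ i, a (j i)) * ∏ i, a (j' i) := by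
  rw [← prod_mul_distrib, ← prod_mul_distrib]
  refine prod_congr rfl fun i _ => ?_
  simp only [Pi.sup_apply, Pi.inf_apply]
  rcases le_total (j i) (j' i) with h | h
  · rw [sup_eq_right.mpr h, inf_eq_left.mpr h, mul_comm]
  · rw [sup_eq_left.mpr h, inf_eq_right.mpr h]

/-- **High-mass clipping at one scale.** Let `WalshClipping` hold at `t` with constants `c₀, C_W`
(hypothesis `hW`). If non-negative cells `C_j` obey the law `|C_j − Θ_θ(j) M m_j| ≤ e₁` and corner NLC
`C_{j∨j'} C_{j∧j'} ≤ C_j C_{j'} + e₂` on the corner `{1,2,3}^t`, with `m_j = ∏_i a_{j_i}`, `a_m ≥ α > 0`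
for `m ∈ {1,2,3}`, `M > 0`, and the singles are `≤ τ`, then the NORMALISED cells `c_j = C_j/(M m_j)`
satisfy the hypotheses of `WalshClipping` with `δ = e₁/(M α^t)`, `η = e₂/(M² α^{2t})` (the model is a
product, `m_{j∨j'} m_{j∧j'} = m_j m_{j'} ≥ α^{2t}`), whence `|Θ_θ(𝟙) − 1| ≤ C_W (δ + η + τ)` provided
`δ + η + τ ≤ c₀`. [folklore] -/
theorem walsh_corner_clip {c₀ C_W : ℝ}
    (hW : ∀ (θ : Finset (Fin t) → ℝ) (c : (Fin t → ℕ) → ℝ) (δ η τ : ℝ),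
      0 ≤ δ → 0 ≤ η → 0 ≤ τ → δ + η + τ ≤ c₀ →
      θ ∅ = 1 → (∀ S, |θ S| ≤ 2) → (∀ i : Fin t, |θ {i}| ≤ τ) →
      (∀ j, IsCorner j → 0 ≤ c j ∧ |c j - walshForm θ j| ≤ δ) →
      (∀ j j', IsCorner j → IsCorner j' → c (j ⊔ j') * c (j ⊓ j') ≤ c j * c j' + η) →
        |walshForm θ (fun _ => 1) - 1| ≤ C_W * (δ + η + τ))
    (θ : Finset (Fin t) → ℝ) (hθ0 : θ ∅ = 1) (hθ2 : ∀ S, |θ S| ≤ 2)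
    (C : (Fin t → ℕ) → ℝ) (hC : ∀ j, 0 ≤ C j) {M α e₁ e₂ τ : ℝ} (hM : 0 < M) (hα : 0 < α)
    (he₁ : 0 ≤ e₁) (he₂ : 0 ≤ e₂) (hτ : 0 ≤ τ)
    (a : ℕ → ℝ) (ha : ∀ m ∈ ({1, 2, 3} : Finset ℕ), α ≤ a m)
    (hlaw : ∀ j, IsCorner j → |C j - walshForm θ j * (M * ∏ i, a (j i))| ≤ e₁)
    (hnlc : ∀ j j', IsCorner j → IsCorner j' → C (j ⊔ j') * C (j ⊓ j') ≤ C j * C j' + e₂)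
    (hsing : ∀ i : Fin t, |θ {i}| ≤ τ)
    (hsum : e₁ / (M * α ^ t) + e₂ / (M ^ 2 * α ^ (2 * t)) + τ ≤ c₀) :
    |walshForm θ (fun _ => 1) - 1| ≤ C_W * (e₁ / (M * α ^ t) + e₂ / (M ^ 2 * α ^ (2 * t)) + τ) := by
  -- corner model densities are at least `α^t`
  have hm : ∀ j : Fin t → ℕ, IsCorner j → α ^ t ≤ ∏ i, a (j i) := by
    intro j hj
    calc α ^ t = ∏ _i : Fin t, α := by rw [prod_const, card_univ, Fintype.card_fin]
      _ ≤ ∏ i, a (j i) := prod_le_prod (fun _ _ => hα.le) fun i _ => ha (j i) (by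
          have h := hj i
          simp only [mem_insert, mem_singleton]
          omega)
  have hαt : 0 < α ^ t := pow_pos hα t
  have hm0 : ∀ j : Fin t → ℕ, IsCorner j → 0 < ∏ i, a (j i) := fun j hj => hαt.trans_le (hm j hj)
  -- the normalised cells
  set c : (Fin t → ℕ) → ℝ := fun j => C j / (M * ∏ i, a (j i)) with hc
  refine hW θ c (e₁ / (M * α ^ t)) (e₂ / (M ^ 2 * α ^ (2 * t))) τ (by positivity) (by positivity) hτ
    hsum hθ0 hθ2 hsing (fun j hj => ?_) (fun j j' hj hj' => ?_)
  · have hden : 0 < M * ∏ i, a (j i) := mul_pos hM (hm0 j hj)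
    refine ⟨div_nonneg (hC j) hden.le, ?_⟩
    have hcj : c j - walshForm θ j = (C j - walshForm θ j * (M * ∏ i, a (j i))) / (M * ∏ i, a (j i)) := by
      rw [eq_div_iff hden.ne']
      simp only [hc]
      rw [sub_mul, div_mul_cancel₀ _ hden.ne']
    rw [hcj, abs_div, abs_of_pos hden]
    calc |C j - walshForm θ j * (M * ∏ i, a (j i))| / (M * ∏ i, a (j i)) ≤ e₁ / (M * ∏ i, a (j i)) :=
          div_le_div_of_nonneg_right (hlaw j hj) hden.le
      _ ≤ e₁ / (M * α ^ t) := by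
          apply div_le_div_of_nonneg_left he₁ (by positivity)
          exact mul_le_mul_of_nonneg_left (hm j hj) hM.le
  · have hmj := hm0 j hj
    have hmj' := hm0 j' hj'
    have hprod := prod_sup_mul_prod_inf a j j'
    have hden : 0 < M ^ 2 * ((∏ i, a (j i)) * ∏ i, a (j' i)) := by positivity
    have hcc : c (j ⊔ j') * c (j ⊓ j') =
        C (j ⊔ j') * C (j ⊓ j') / (M ^ 2 * ((∏ i, a (j i)) * ∏ i, a (j' i))) := by
      simp only [hc]
      rw [div_mul_div_comm, ← hprod]
      ring
    have hcc' : c j * c j' = C j * C j' / (M ^ 2 * ((∏ i, a (j i)) * ∏ i, a (j' i))) := by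
      simp only [hc]
      rw [div_mul_div_comm]
      ring
    rw [hcc, hcc']
    calc C (j ⊔ j') * C (j ⊓ j') / (M ^ 2 * ((∏ i, a (j i)) * ∏ i, a (j' i)))
        ≤ (C j * C j' + e₂) / (M ^ 2 * ((∏ i, a (j i)) * ∏ i, a (j' i))) :=
          div_le_div_of_nonneg_right (hnlc j j' hj hj') hden.le
      _ = C j * C j' / (M ^ 2 * ((∏ i, a (j i)) * ∏ i, a (j' i))) +
            e₂ / (M ^ 2 * ((∏ i, a (j i)) * ∏ i, a (j' i))) := add_div _ _ _
      _ ≤ C j * C j' / (M ^ 2 * ((∏ i, a (j i)) * ∏ i, a (j' i))) + e₂ / (M ^ 2 * α ^ (2 * t)) := by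
          gcongr
          calc α ^ (2 * t) = α ^ t * α ^ t := by rw [two_mul, pow_add]
            _ ≤ (∏ i, a (j i)) * ∏ i, a (j' i) := mul_le_mul (hm j hj) (hm j' hj') hαt.le hmj.le

end Summit.Parity.GeneralizedHardyLittlewood.Theorems.AbsoluteUpgrade

end
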